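/-
Copyright (c) 2026 the pub-hodgecm-mathlib formalisation cell (harness21).  Prover seat hodgecm-mathlib-K2Liu-p02 (g7), Track B «K2-LIT» ∕ hLiu418
#184♮, #42S payer road (σ), V5-inst (f) PART 2b file 1 — (U) THE EXPLICIT UNIPOTENT JUNCTION (K2Liu-p02 (g7) bus 14:07∕14:08Z).  THEOREMS ONLY.
-/
import Summits.HodgeConjecture.HodgeConjecture.Theorems.K2LiuDeltaSpTransportSiegelLetters   -- ★ (N) `exists_deltaTransport_iotaD_eq_unipotentSp` lineage, `deltaCoords_symm_inr`
import Summits.HodgeConjecture.HodgeConjecture.Theorems.K2LiuDeltaModelRealFrame              -- ★ I-0 `reFrame`, `reFrame_apply`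
import Summits.HodgeConjecture.HodgeConjecture.Theorems.K2LiuDeltaSpTransportAdaptedBlocks    -- ★ MASTER FORMULA `deltaTransport_iotaD_apply`, `eD_dblV`, `eD_adblV`
import HarnessLib

/-!
# Crux `HLiu418`, (σ) V5-inst (f), file 1: THE ADAPTED SIEGEL UNIPOTENT `u = (1 T; 0 1)` IN THE Δ-MODEL, EXPLICITLY —
# `σ′(R b, 0) = (R b, R (T b))`, so `σ′ = unipotentSp β b_T` with `b_T (R b) = R (T b)`, and the second-degree exponent is
# `½ β_Δ(R b, R (T b)) = re(b)ᵀ T₀ im(T b) − re(T b)ᵀ T₀ im(b)`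

Cell `hodgecm-mathlib`, crux item hLiu418 = `stmt-HodgeConjecture-24832`; squad K2 ∕ K2Liu; prover K2Liu-p02 (g7).  THEOREMS ONLY (no `def`, no instance, no
notation, no named-fact hypothesis, no `sorry`); lane `--supports stmt-HodgeConjecture-24832 --as helper`.  Generic D10 currency `(F E c hcδ hδ hd v n hT₀ hT₀d hJD)` of
★ `K2LiuDeltaSpTransportSiegelLetters`.

WHY.  ★ (N) `exists_deltaTransport_iotaD_eq_unipotentSp` (K2Liu-p09) says the Δ-transport `σ′ = deltaCoords ∘ ι(u) ∘ deltaCoords⁻¹` of an adapted Siegel unipotent `u`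
(`adapt (matA u) = (1 T; 0 1)`) is `unipotentSp β b` for SOME `b`, dropping the clause `b x = (σ′(x,0)).2` of ★ `exists_eq_unipotentSp`.  The `hN` binder of ★ V8e
`face_two_of_laws` (`ω(n) Φ x = ψ(η ⬝ᵥ q x) · Φ x`) needs `b` and the exponent `½ β(x, b x)` EXPLICITLY.  Here: **`deltaTransport_iotaD_apply_reFrame_zero`** — `σ′(R b, 0) = (R b, R (T *ᵥ b))`
(`R = reFrame` ★ I-0; the ★ MASTER FORMULA `K2LiuDeltaSpTransportAdaptedBlocks.deltaTransport_iotaD_apply` at `a = 0`, blocks `(1, T; 0, 1)`: `ι(u)` fixes `Δ` and shears `Δ⁻ ∋ (b, −b) ↦ + (Tb, Tb) ∈ Δ`); **`exists_deltaTransport_iotaD_eq_unipotentSp_reFrame`** — `σ′ = unipotentSp β b_T` with `b_T (R b) = R (T *ᵥ b)` for all `b`; **`half_deltaGram_reFrame_reFrame`** — the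
exponent `⅟2 · β_Δ(R b, R b′) = re(b) ⬝ᵥ T₀ *ᵥ im(b′) − re(b′) ⬝ᵥ T₀ *ᵥ im(b)` (★ `deltaGram_glue`), whence at `b′ = T b` the second-degree character of `n(T)`.
References: [Weil1964] n° 6 p. 151 (`t₀(σ)`), n° 13; [Kudla1994] §2–§3 Thm. 3.1; [MoeglinVignerasWaldspurger1987] Chap. 2 I.7, II.6; [HarrisKudlaSweet1996] §1 (1.11).
HONEST LABEL.  Count-neutral helper: `HC_CM` is proved only modulo the 7 printed citations (2 remaining named inputs: hLiu418 = `stmt-HodgeConjecture-24832`,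
h413 = `stmt-HodgeConjecture-24833`) until rung 0 closes.
-/

set_option autoImplicit false
set_option linter.dupNamespace false -- the mandated namespace repeats `HodgeConjecture.HodgeConjecture`

noncomputable section

open Matrix
open NumberField IsDedekindDomain
open Literature.NumberTheory.Automorphic Literature.NumberTheory.Automorphic.UnitaryGroup
open Literature.NumberTheory.Automorphic.UnitaryGroup.QuadraticCoordinates
open Literature.RepresentationTheory.HeisenbergGroup
open Literature.NumberTheory.GelbartRogawski1991 Literature.NumberTheory.GelbartRogawski1991.AdaptedBlocks
open Literature.NumberTheory.GelbartRogawski1991.UnitaryDualPair.LocalSplitting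
open Summit.HodgeConjecture.HodgeConjecture.Cruxes.HLiu418.K2LiuDeltaSpTransportSiegelLetters
open Summit.HodgeConjecture.HodgeConjecture.Cruxes.HLiu418.K2LiuDeltaModelRealFrame
open Summit.HodgeConjecture.HodgeConjecture.Cruxes.HLiu418.K2LiuDeltaSpTransportAdaptedBlocks

namespace Summit.HodgeConjecture.HodgeConjecture.Cruxes.HLiu418.K2LiuDeltaSpTransportUnipotentExplicit

variable (F : Type) [Field F] [NumberField F] (E : Type) [Field E] [NumberField E] [Algebra F E]
  [Algebra.IsQuadraticExtension F E] (c : E ≃ₐ[F] E)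
  {δ : E} (hcδ : c δ = -δ) (hδ : δ ≠ 0) {d : F} (hd : δ * δ = algebraMap F E d)
  (v : HeightOneSpectrum (𝓞 F)) (n : ℕ) {T₀ : Matrix (Fin n) (Fin n) F} (hT₀ : T₀.IsSymm) (hT₀d : IsUnit T₀.det)
  {JD : Matrix (Fin (n + n)) (Fin (n + n)) E} (hJD : JD = (gramD F n T₀).map (algebraMap F E))

/-! ## §1 The dictionary `eD (adblV b) ↔ (R b, 0)`, `eD (dblV a) ↔ (0, R a)` -/

/-- `deltaCoords⁻¹ (x, 0) = nablaW (x_L) (x_R)` — the `X_Δ`-axis is the antidiagonal Lagrangian `ℓ_∇` (companion of ★ `deltaCoords_symm_inr`). [cite: Kudla1994, §2] -/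
theorem deltaCoords_symm_inl (x : Fin (n + n) → v.adicCompletion F) :
    (deltaCoords (K := v.adicCompletion F) (e₂ n)).symm (x, 0) = nablaW (e₂ n) (resL (e₂ n) x) (resR (e₂ n) x) := by
  rw [LinearEquiv.symm_apply_eq, deltaCoords_nablaW, glue_resL_resR]

/-- **`deltaCoords (eD (adblV b)) = (R b, 0)`** — the `X_Δ`-coordinate of `(b, −b)` is the real frame `R b` of ★ I-0. [cite: Kudla1994, §2–§3] -/
theorem deltaCoords_eD_adblV (b : Fin n → LocalRing E v) :
    deltaCoords (K := v.adicCompletion F) (e₂ n) (eD F E c hcδ hδ hd v n (adblV b)) = (reFrame F E c hcδ hδ v n b, 0) := by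
  rw [eD_adblV, deltaCoords_nablaW, reFrame_apply]

/-- **`deltaCoords (eD (dblV a)) = (0, R a)`** — the `Y_Δ`-coordinate of `(a, a)`. [cite: Kudla1994, §2–§3] -/
theorem deltaCoords_eD_dblV (a : Fin n → LocalRing E v) :
    deltaCoords (K := v.adicCompletion F) (e₂ n) (eD F E c hcδ hδ hd v n (dblV a)) = (0, reFrame F E c hcδ hδ v n a) := by
  rw [eD_dblV, deltaCoords_deltaW, reFrame_apply]

/-! ## §2 (U): the Δ-transport of an adapted unipotent, explicitly -/

include hT₀ hJD in
/-- **(U) THE ADAPTED UNIPOTENT IN THE Δ-MODEL, EXPLICITLY**: for `u` with `adapt (matA u) = (1 T; 0 1)`, the transported element `σ′ = deltaCoords ∘ ι(u) ∘ deltaCoords⁻¹`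
satisfies `σ′ (R b, 0) = (R b, R (T *ᵥ b))` — `u` fixes `Δ` and shears `(b, −b) ↦ (b, −b) + (T b, T b)` (★ `iotaD_apply_eD`). [cite: Kudla1994, §3 Thm. 3.1] [cite: Weil1964, n° 6, p. 151] -/
theorem deltaTransport_iotaD_apply_reFrame_zero (u : UnitaryGroup.localPi E c (n + n) JD v) (T : Matrix (Fin n) (Fin n) (LocalRing E v))
    (hu : adapt (matA F E c v n u) = Matrix.fromBlocks 1 T 0 1) (b : Fin n → LocalRing E v) :
    ((deltaSymplecticTransport (e₂ n) (T₀.map (algebraMap F (v.adicCompletion F))) (localGram_gramD F v n (T₀ := T₀))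
        (iotaD F E c hcδ hδ hd v n hT₀ hJD u) :
        symplecticGroup (polar (Matrix.toLinearMap₂' (v.adicCompletion F) (deltaGram (e₂ n) (T₀.map (algebraMap F (v.adicCompletion F))))))) :
        ((Fin (n + n) → v.adicCompletion F) × (Fin (n + n) → v.adicCompletion F)) ≃ₗ[v.adicCompletion F]
          ((Fin (n + n) → v.adicCompletion F) × (Fin (n + n) → v.adicCompletion F))) (reFrame F E c hcδ hδ v n b, 0) =
      (reFrame F E c hcδ hδ v n b, reFrame F E c hcδ hδ v n (T *ᵥ b)) := by
  rw [deltaSymplecticTransport_apply]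
  have hw : (deltaCoords (K := v.adicCompletion F) (e₂ n)).symm (reFrame F E c hcδ hδ v n b, 0) = eD F E c hcδ hδ hd v n (adblV b) := by
    rw [LinearEquiv.symm_apply_eq, deltaCoords_eD_adblV]
  rw [hw, show (iotaD F E c hcδ hδ hd v n hT₀ hJD u).1 (eD F E c hcδ hδ hd v n (adblV b)) =
      toLin F v (iotaD F E c hcδ hδ hd v n hT₀ hJD u) (eD F E c hcδ hδ hd v n (adblV b)) from rfl,
    iotaD_apply_eD F E c hcδ hδ hd v n hT₀ hJD u T hu, halfDiff_adblV, map_add, deltaCoords_eD_adblV, deltaCoords_eD_dblV, Prod.mk_add_mk,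
    add_zero, zero_add]

include hT₀ hT₀d hJD in
/-- **(U′) `σ′ = unipotentSp β b_T` WITH `b_T (R b) = R (T *ᵥ b)`** — ★ (N) `exists_deltaTransport_iotaD_eq_unipotentSp` keeping the explicit clause of ★ `exists_eq_unipotentSp`,
read through (U). [cite: Kudla1994, §3 Thm. 3.1] [cite: Weil1964, n° 6, p. 151] -/
theorem exists_deltaTransport_iotaD_eq_unipotentSp_reFrame (u : UnitaryGroup.localPi E c (n + n) JD v) (T : Matrix (Fin n) (Fin n) (LocalRing E v))
    (hu : adapt (matA F E c v n u) = Matrix.fromBlocks 1 T 0 1) :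
    ∃ (b : (Fin (n + n) → v.adicCompletion F) →ₗ[v.adicCompletion F] (Fin (n + n) → v.adicCompletion F))
      (hb : ∀ x x' : Fin (n + n) → v.adicCompletion F,
        Matrix.toLinearMap₂' (v.adicCompletion F) (deltaGram (e₂ n) (T₀.map (algebraMap F (v.adicCompletion F)))) x (b x') =
          Matrix.toLinearMap₂' (v.adicCompletion F) (deltaGram (e₂ n) (T₀.map (algebraMap F (v.adicCompletion F)))) x' (b x)),
      deltaSymplecticTransport (e₂ n) (T₀.map (algebraMap F (v.adicCompletion F))) (localGram_gramD F v n (T₀ := T₀))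
          (iotaD F E c hcδ hδ hd v n hT₀ hJD u) = unipotentSp _ b hb ∧
        ∀ b' : Fin n → LocalRing E v, b (reFrame F E c hcδ hδ v n b') = reFrame F E c hcδ hδ v n (T *ᵥ b') := by
  set σ' := deltaSymplecticTransport (e₂ n) (T₀.map (algebraMap F (v.adicCompletion F))) (localGram_gramD F v n (T₀ := T₀))
      (iotaD F E c hcδ hδ hd v n hT₀ hJD u) with hσ'
  -- `σ′` fixes `0 × Y_Δ` pointwise and is the identity on `X_Δ` modulo `Y_Δ`
  have hy : ∀ y : Fin (n + n) → v.adicCompletion F,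
      (σ' : ((Fin (n + n) → v.adicCompletion F) × (Fin (n + n) → v.adicCompletion F)) ≃ₗ[v.adicCompletion F]
        ((Fin (n + n) → v.adicCompletion F) × (Fin (n + n) → v.adicCompletion F))) (0, y) = (0, y) := by
    intro y
    rw [hσ', deltaSymplecticTransport_apply]
    have hw : (deltaCoords (K := v.adicCompletion F) (e₂ n)).symm (0, y) ∈ deltaLagrangian F v n := by
      rw [deltaCoords_symm_inr]
      exact K2LiuDoublingEigenfunctionalNonvanishing.deltaW_mem_deltaLagrangian F v n _ _
    have h1 := iotaD_apply_of_mem_deltaLagrangian F E c hcδ hδ hd v n hT₀ hJD u T hu hw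
    rw [show (iotaD F E c hcδ hδ hd v n hT₀ hJD u).1 ((deltaCoords (K := v.adicCompletion F) (e₂ n)).symm (0, y)) =
        toLin F v (iotaD F E c hcδ hδ hd v n hT₀ hJD u) ((deltaCoords (K := v.adicCompletion F) (e₂ n)).symm (0, y)) from rfl,
      h1, LinearEquiv.apply_symm_apply]
  have hx : ∀ x : Fin (n + n) → v.adicCompletion F,
      ((σ' : ((Fin (n + n) → v.adicCompletion F) × (Fin (n + n) → v.adicCompletion F)) ≃ₗ[v.adicCompletion F]
        ((Fin (n + n) → v.adicCompletion F) × (Fin (n + n) → v.adicCompletion F))) (x, 0)).1 = x := by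
    intro x
    obtain ⟨b', rfl⟩ := (reFrame F E c hcδ hδ v n).surjective x
    rw [hσ', deltaTransport_iotaD_apply_reFrame_zero F E c hcδ hδ hd v n hT₀ hJD u T hu b']
  obtain ⟨b, hb, heq, hbx⟩ := exists_eq_unipotentSp (deltaGram (e₂ n) (T₀.map (algebraMap F (v.adicCompletion F))))
    (isUnit_det_deltaGram (e₂ n) _ (isUnit_det_map_local F v n hT₀d)) σ' hy hx
  refine ⟨b, hb, heq, fun b' => ?_⟩
  rw [← hbx, hσ', deltaTransport_iotaD_apply_reFrame_zero F E c hcδ hδ hd v n hT₀ hJD u T hu b']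

/-! ## §3 The second-degree exponent on the real frame -/

/-- **`½ β_Δ(R b, R b′) = re(b) ⬝ᵥ T₀ *ᵥ im(b′) − re(b′) ⬝ᵥ T₀ *ᵥ im(b)`** (★ `deltaGram_glue` on `R b = re(b) ⊔ im(b)`): at `b′ = T *ᵥ b` this is the exponent of the second-degree
character by which `n(T)` acts on `𝒮(X_Δ)` (★ A2d `exists_toRep_transport_eq_smul_unipotent`). [cite: Kudla1994, §2, §3 Thm. 3.1] [cite: Weil1964, n° 6, p. 151] -/
theorem half_deltaGram_reFrame_reFrame (b b' : Fin n → LocalRing E v) :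
    ⅟(2 : v.adicCompletion F) *
        Matrix.toLinearMap₂' (v.adicCompletion F) (deltaGram (e₂ n) (T₀.map (algebraMap F (v.adicCompletion F))))
          (reFrame F E c hcδ hδ v n b) (reFrame F E c hcδ hδ v n b') =
      (fun i => re (quadraticLocalEquiv E v c hcδ hδ).toLinearEquiv.toAddEquiv (b i)) ⬝ᵥ
          (T₀.map (algebraMap F (v.adicCompletion F)) *ᵥ fun i => im (quadraticLocalEquiv E v c hcδ hδ).toLinearEquiv.toAddEquiv (b' i)) -
        (fun i => re (quadraticLocalEquiv E v c hcδ hδ).toLinearEquiv.toAddEquiv (b' i)) ⬝ᵥ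
          (T₀.map (algebraMap F (v.adicCompletion F)) *ᵥ fun i => im (quadraticLocalEquiv E v c hcδ hδ).toLinearEquiv.toAddEquiv (b i)) := by
  rw [reFrame_apply, reFrame_apply, deltaGram_glue, Matrix.toLinearMap₂'_apply', Matrix.toLinearMap₂'_apply', mul_sub, ← mul_assoc, ← mul_assoc,
    invOf_mul_self, one_mul, one_mul]

end Summit.HodgeConjecture.HodgeConjecture.Cruxes.HLiu418.K2LiuDeltaSpTransportUnipotentExplicit

end
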